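import Literature.Geometry.Kaehler.RiemannSurfaceSubharmonicProofs
import Mathlib.Analysis.Convex.PathConnected
import HarnessLib

/-!
# Subharmonic functions on a Riemann surface, II: chart discs and the maximum principle

Topic `Literature/Geometry/Kaehler` (PROOF-ONLY; continues `RiemannSurfaceSubharmonicProofs.lean`).
I-Hsiung Lin, *Classical Complex Analysis: A Geometric Approach*, vol. 2 (2011), §7.3: the «Jordan disks» after
(7.3.1) (here: CHART DISCS, `RiemannSurface.IsChartDisc` / `chartDisc` / `closedChartDisc` — open, preconnected,
with compact closure inside the chart domain) and the MAXIMUM PRINCIPLE for subharmonic functions ((7.3.1.8) form: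
«if u attains its maximum at an interior point … u is a constant»; L. Ahlfors, *Complex Analysis* (3rd ed. 1979)
ch. 6 §6.3), in the two shapes Perron's method consumes:

* `IsSubharmonicOn.eqOn_of_isMaxOn` — STRONG maximum principle on a preconnected open set (clopen argument: a
  chart circle through a point where `v < max` has average `< max`, `circleAverage_lt_of_exists_lt`);
* `IsSubharmonicOn.le_of_le_on_sphere` — WEAK maximum principle on a closed chart disc: continuous on `D̄`,
  subharmonic on `D`, `≤ K` on the boundary circle ⟹ `≤ K` on `D̄`.

Everything is proved; no definition, no named fact.  Nothing here bears on [IUTchIII] Cor. 3.12 (classical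
potential theory for the abc-iut cell's programme «UNIF-G1P» Tier 2, bricks P1/P2).
-/

noncomputable section

open Set Filter Metric Topology Complex
open scoped Manifold ContDiff Topology

namespace Literature.Geometry.Kaehler

namespace RiemannSurface

variable {X : Type*} [TopologicalSpace X] [ChartedSpace ℂ X]

/-! ### Chart discs -/

section ChartDisc

variable {p : X} {R : ℝ}

/-- Membership in the open chart disc. [cite: Lin2011, §7.3 (7.3.1)–(7.3.2)] -/
theorem mem_chartDisc_iff {y : X} : y ∈ chartDisc p R ↔
    y ∈ (extChartAt 𝓘(ℂ, ℂ) p).source ∧ extChartAt 𝓘(ℂ, ℂ) p y ∈ ball (extChartAt 𝓘(ℂ, ℂ) p p) R :=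
  Iff.rfl

/-- Membership in the closed chart disc. [cite: Lin2011, §7.3 (7.3.1)–(7.3.2)] -/
theorem mem_closedChartDisc_iff {y : X} : y ∈ closedChartDisc p R ↔
    y ∈ (extChartAt 𝓘(ℂ, ℂ) p).source ∧ extChartAt 𝓘(ℂ, ℂ) p y ∈ closedBall (extChartAt 𝓘(ℂ, ℂ) p p) R :=
  Iff.rfl

/-- The open chart disc lies in the closed one. [cite: Lin2011, §7.3 (7.3.1)–(7.3.2)] -/
theorem chartDisc_subset_closedChartDisc : chartDisc p R ⊆ closedChartDisc p R :=
  fun _ hy => ⟨hy.1, ball_subset_closedBall hy.2⟩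

/-- The closed chart disc lies in the chart domain. [cite: Lin2011, §7.3 (7.3.1)–(7.3.2)] -/
theorem closedChartDisc_subset_source : closedChartDisc p R ⊆ (extChartAt 𝓘(ℂ, ℂ) p).source :=
  fun _ hy => hy.1

/-- The centre lies in its closed chart disc. [cite: Lin2011, §7.3 (7.3.1)–(7.3.2)] -/
theorem mem_closedChartDisc_self (hR : 0 ≤ R) : p ∈ closedChartDisc p R :=
  ⟨mem_extChartAt_source p, mem_closedBall_self hR⟩

/-- The centre lies in its open chart disc. [cite: Lin2011, §7.3 (7.3.1)–(7.3.2)] -/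
theorem mem_chartDisc_self (hR : 0 < R) : p ∈ chartDisc p R :=
  ⟨mem_extChartAt_source p, mem_ball_self hR⟩

/-- The open chart disc is open. [cite: Lin2011, §7.3 (7.3.1)–(7.3.2)] -/
theorem isOpen_chartDisc : IsOpen (chartDisc p R) :=
  (continuousOn_extChartAt p).isOpen_inter_preimage (isOpen_extChartAt_source p) isOpen_ball

/-- The open chart disc is the image of the plane disc under the inverse chart. [cite: Lin2011, §7.3 (7.3.1)–(7.3.2)] -/
theorem chartDisc_eq_image (hD : IsChartDisc p R) :
    chartDisc p R = (extChartAt 𝓘(ℂ, ℂ) p).symm '' ball (extChartAt 𝓘(ℂ, ℂ) p p) R := by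
  ext y
  constructor
  · rintro ⟨hy, hb⟩
    exact ⟨_, hb, (extChartAt 𝓘(ℂ, ℂ) p).left_inv hy⟩
  · rintro ⟨z, hz, rfl⟩
    have hzt : z ∈ (extChartAt 𝓘(ℂ, ℂ) p).target := hD.2 (ball_subset_closedBall hz)
    refine ⟨(extChartAt 𝓘(ℂ, ℂ) p).map_target hzt, ?_⟩
    rw [mem_preimage, (extChartAt 𝓘(ℂ, ℂ) p).right_inv hzt]
    exact hz

/-- The closed chart disc is the image of the closed plane disc under the inverse chart. [cite: Lin2011, §7.3 (7.3.1)–(7.3.2)] -/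
theorem closedChartDisc_eq_image (hD : IsChartDisc p R) :
    closedChartDisc p R = (extChartAt 𝓘(ℂ, ℂ) p).symm '' closedBall (extChartAt 𝓘(ℂ, ℂ) p p) R := by
  ext y
  constructor
  · rintro ⟨hy, hb⟩
    exact ⟨_, hb, (extChartAt 𝓘(ℂ, ℂ) p).left_inv hy⟩
  · rintro ⟨z, hz, rfl⟩
    have hzt : z ∈ (extChartAt 𝓘(ℂ, ℂ) p).target := hD.2 hz
    refine ⟨(extChartAt 𝓘(ℂ, ℂ) p).map_target hzt, ?_⟩
    rw [mem_preimage, (extChartAt 𝓘(ℂ, ℂ) p).right_inv hzt]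
    exact hz

/-- The closed chart disc is compact. [cite: Lin2011, §7.3 (7.3.1)–(7.3.2)] -/
theorem isCompact_closedChartDisc (hD : IsChartDisc p R) : IsCompact (closedChartDisc p R) := by
  rw [closedChartDisc_eq_image hD]
  exact (isCompact_closedBall _ _).image_of_continuousOn ((continuousOn_extChartAt_symm p).mono hD.2)

/-- The open chart disc is preconnected (image of a convex set). [cite: Lin2011, §7.3 (7.3.1)–(7.3.2)] -/
theorem isPreconnected_chartDisc (hD : IsChartDisc p R) : IsPreconnected (chartDisc p R) := by
  rw [chartDisc_eq_image hD]
  exact (convex_ball _ _).isPreconnected.image _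
    ((continuousOn_extChartAt_symm p).mono (ball_subset_closedBall.trans hD.2))

/-- A point of the closed chart disc whose chart image lies on the circle is in the closure of the open chart
disc. [cite: Lin2011, §7.3 (7.3.1)–(7.3.2)] -/
theorem mem_closure_chartDisc_of_mem_sphere (hD : IsChartDisc p R) {y : X} (hy : y ∈ closedChartDisc p R)
    (hs : extChartAt 𝓘(ℂ, ℂ) p y ∈ sphere (extChartAt 𝓘(ℂ, ℂ) p p) R) : y ∈ closure (chartDisc p R) := by
  rw [chartDisc_eq_image hD]
  have hcl : closure (ball (extChartAt 𝓘(ℂ, ℂ) p p) R) = closedBall (extChartAt 𝓘(ℂ, ℂ) p p) R :=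
    closure_ball _ hD.1.ne'
  have hcont : ContinuousOn (extChartAt 𝓘(ℂ, ℂ) p).symm (closure (ball (extChartAt 𝓘(ℂ, ℂ) p p) R)) := by
    rw [hcl]; exact (continuousOn_extChartAt_symm p).mono hD.2
  have hmem : extChartAt 𝓘(ℂ, ℂ) p y ∈ closure (ball (extChartAt 𝓘(ℂ, ℂ) p p) R) := by
    rw [hcl]; exact sphere_subset_closedBall hs
  have := hcont.image_closure ⟨_, hmem, rfl⟩
  rwa [(extChartAt 𝓘(ℂ, ℂ) p).left_inv hy.1] at this

/-- For every point of an open set there is a chart disc about it whose closure lies in the set. [cite: Lin2011,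
§7.3 after (7.3.1)] -/
theorem exists_isChartDisc_subset {U : Set X} (hU : IsOpen U) {x : X} (hx : x ∈ U) :
    ∃ R, IsChartDisc x R ∧ closedChartDisc x R ⊆ U := by
  obtain ⟨ε, hε, h1, h2⟩ := exists_ball_subset (hU.mem_nhds hx)
  refine ⟨ε / 2, ⟨half_pos hε, (closedBall_subset_ball (half_lt_self hε)).trans h1⟩, fun y hy => ?_⟩
  have := h2 _ (closedBall_subset_ball (half_lt_self hε) hy.2)
  rwa [(extChartAt 𝓘(ℂ, ℂ) x).left_inv hy.1] at this

end ChartDisc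

/-! ### The maximum principle -/

/-- A continuous function `≤ M` on a circle with a point of strict inequality has circle average `< M`.
[cite: Lin2011, §7.3 (7.3.1)–(7.3.2)] -/
theorem circleAverage_lt_of_exists_lt {g : ℂ → ℝ} {c : ℂ} {r M : ℝ} (hr : 0 < r)
    (hg : ContinuousOn g (sphere c r)) (hle : ∀ z ∈ sphere c r, g z ≤ M)
    (hlt : ∃ z ∈ sphere c r, g z < M) : Real.circleAverage g c r < M := by
  obtain ⟨w, hw, hwM⟩ := hlt
  have hwmem : w ∈ circleMap c r '' Ioc 0 (2 * Real.pi) := by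
    rw [image_circleMap_Ioc, abs_of_pos hr]; exact hw
  obtain ⟨θ₀, hθ₀, hθ₀w⟩ := hwmem
  have hsph : ∀ θ : ℝ, circleMap c r θ ∈ sphere c r := fun θ => by
    simpa only [abs_of_pos hr] using circleMap_mem_sphere' c r θ
  have hI : (∫ θ in (0 : ℝ)..2 * Real.pi, g (circleMap c r θ)) < ∫ _ in (0 : ℝ)..2 * Real.pi, M := by
    apply intervalIntegral.integral_lt_integral_of_continuousOn_of_le_of_exists_lt Real.two_pi_pos
    · exact hg.comp (continuous_circleMap c r).continuousOn fun θ _ => hsph θ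
    · exact continuousOn_const
    · exact fun θ _ => hle _ (hsph θ)
    · exact ⟨θ₀, Ioc_subset_Icc_self hθ₀, by rwa [hθ₀w]⟩
  rw [intervalIntegral.integral_const, smul_eq_mul, sub_zero] at hI
  rw [Real.circleAverage_def, smul_eq_mul]
  calc (2 * Real.pi)⁻¹ * ∫ θ in (0 : ℝ)..2 * Real.pi, g (circleMap c r θ)
      < (2 * Real.pi)⁻¹ * (2 * Real.pi * M) := mul_lt_mul_of_pos_left hI (inv_pos.2 Real.two_pi_pos)
    _ = M := by field_simp

namespace IsSubharmonicOn

variable {v : X → ℝ} {U : Set X}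

/-- Local step of the maximum principle: where a subharmonic function attains its maximum over an open set,
it is locally constant. [cite: Lin2011, §7.3 (7.3.1.8) with (6.4.1); AhlforsCA1979, ch. 6 §6.3] -/
theorem eventually_eq_of_isMaxOn (hU : IsOpen U) (hv : IsSubharmonicOn v U) {x : X} (hx : x ∈ U)
    (hmax : IsMaxOn v U x) : ∀ᶠ y in 𝓝 x, v y = v x := by
  set c := extChartAt 𝓘(ℂ, ℂ) x x with hc
  -- a radius below which: sub-mean-value holds, the closed discs are in the target and pull back into `U`
  obtain ⟨δ, hδ, hδP⟩ := (nhdsGT_basis (0 : ℝ)).eventually_iff.1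
    ((hv.2 x hx).and (eventually_closedBall_subset_of_isOpen hU hx))
  -- the neighbourhood: chart-preimage of the open ball of radius `δ`
  have hN : (extChartAt 𝓘(ℂ, ℂ) x).source ∩ extChartAt 𝓘(ℂ, ℂ) x ⁻¹' ball c δ ∈ 𝓝 x :=
    ((continuousOn_extChartAt x).isOpen_inter_preimage (isOpen_extChartAt_source x) isOpen_ball).mem_nhds
      ⟨mem_extChartAt_source x, mem_ball_self hδ⟩
  filter_upwards [hN] with y hy
  obtain ⟨hys, hyb⟩ := hy
  by_contra hne
  -- `y ≠ x` and `r := dist (chart y) c ∈ (0, δ)`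
  have hyx : extChartAt 𝓘(ℂ, ℂ) x y ≠ c := by
    intro h
    apply hne
    have : y = x := by
      rw [← (extChartAt 𝓘(ℂ, ℂ) x).left_inv hys, h, hc, extChartAt_to_inv]
    rw [this]
  set r := dist (extChartAt 𝓘(ℂ, ℂ) x y) c with hr
  have hr0 : 0 < r := dist_pos.2 hyx
  have hrδ : r < δ := mem_ball.1 hyb
  obtain ⟨hsmv, hball⟩ := hδP ⟨hr0, hrδ⟩
  -- `y ∈ U` and `v y < v x`
  have hyU : y ∈ U := by
    have := hball.2 _ (mem_closedBall.2 hr.symm.le)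
    rwa [(extChartAt 𝓘(ℂ, ℂ) x).left_inv hys] at this
  have hlt : v y < v x := lt_of_le_of_ne (hmax hyU) hne
  -- the pull-back is continuous on the circle, `≤ v x` there, and `< v x` at `chart y`
  have hcont : ContinuousOn (chartPullback x v) (sphere c r) :=
    (continuousOn_chartPullback_closedBall hv.1 hball).mono sphere_subset_closedBall
  have hle : ∀ z ∈ sphere c r, chartPullback x v z ≤ v x := fun z hz =>
    hmax (hball.2 z (sphere_subset_closedBall hz))
  have hys' : extChartAt 𝓘(ℂ, ℂ) x y ∈ sphere c r := mem_sphere.2 rfl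
  have hlt' : ∃ z ∈ sphere c r, chartPullback x v z < v x :=
    ⟨_, hys', by simpa only [chartPullback, Function.comp_apply, (extChartAt 𝓘(ℂ, ℂ) x).left_inv hys]⟩
  exact absurd hsmv (not_le.2 (circleAverage_lt_of_exists_lt hr0 hcont hle hlt'))

/-- **The maximum principle** ((7.3.1.8) form; Ahlfors ch. 6 §6.3): a subharmonic function on a preconnected
open set which attains its maximum there is constant. [cite: Lin2011, §7.3 (7.3.1.8); AhlforsCA1979, ch. 6
§6.3] -/
theorem eqOn_of_isMaxOn (hU : IsOpen U) (hUc : IsPreconnected U) (hv : IsSubharmonicOn v U) {x₀ : X}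
    (hx₀ : x₀ ∈ U) (hmax : IsMaxOn v U x₀) : EqOn v (fun _ => v x₀) U := by
  intro y hy
  by_contra hne
  have hlt : v y < v x₀ := lt_of_le_of_ne (hmax hy) hne
  set U₁ : Set X := U ∩ v ⁻¹' Iio (v x₀)
  set U₂ : Set X := interior {w | v w = v x₀}
  have hU₁ : IsOpen U₁ := hv.1.isOpen_inter_preimage hU isOpen_Iio
  have hcover : U ⊆ U₁ ∪ U₂ := by
    intro w hw
    rcases lt_or_eq_of_le (show v w ≤ v x₀ from hmax hw) with h | h
    · exact Or.inl ⟨hw, h⟩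
    · exact Or.inr (mem_interior_iff_mem_nhds.2 (by
        have hmax' : IsMaxOn v U w := fun z hz => (hmax hz).trans_eq h.symm
        filter_upwards [hv.eventually_eq_of_isMaxOn hU hw hmax'] with z hz
        exact hz.trans h))
  obtain ⟨w, _, hw₁, hw₂⟩ := hUc U₁ U₂ hU₁ isOpen_interior hcover ⟨y, hy, hy, hlt⟩
    ⟨x₀, hx₀, mem_interior_iff_mem_nhds.2 (hv.eventually_eq_of_isMaxOn hU hx₀ hmax)⟩
  have hw₂' : v w = v x₀ := interior_subset (s := {w | v w = v x₀}) hw₂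
  have hw₁' : v w < v x₀ := hw₁.2
  exact absurd hw₂' (ne_of_lt hw₁')

/-- **Weak maximum principle on a closed chart disc**: a function continuous on the closed chart disc and
subharmonic on the open one is bounded on the closed disc by its bound on the boundary circle.
[cite: Lin2011, §7.3 (7.3.5) «min f ≤ u ≤ max f»; AhlforsCA1979, ch. 6 §6.3] -/
theorem le_of_le_on_sphere [T2Space X] {w : X → ℝ} {p : X} {R K : ℝ} (hD : IsChartDisc p R)
    (hw : IsSubharmonicOn w (chartDisc p R)) (hwc : ContinuousOn w (closedChartDisc p R))
    (hK : ∀ y ∈ closedChartDisc p R,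
      extChartAt 𝓘(ℂ, ℂ) p y ∈ sphere (extChartAt 𝓘(ℂ, ℂ) p p) R → w y ≤ K) :
    ∀ y ∈ closedChartDisc p R, w y ≤ K := by
  obtain ⟨y₀, hy₀, hmax⟩ := (isCompact_closedChartDisc hD).exists_isMaxOn
    ⟨p, mem_closedChartDisc_self hD.1.le⟩ hwc
  -- a boundary point
  set c := extChartAt 𝓘(ℂ, ℂ) p p with hc
  have hz₁ : c + R ∈ sphere c R := by simp [abs_of_pos hD.1]
  set y₁ := (extChartAt 𝓘(ℂ, ℂ) p).symm (c + R) with hy₁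
  have hz₁t : c + R ∈ (extChartAt 𝓘(ℂ, ℂ) p).target := hD.2 (sphere_subset_closedBall hz₁)
  have hy₁e : extChartAt 𝓘(ℂ, ℂ) p y₁ = c + R := by
    rw [hy₁]; exact (extChartAt 𝓘(ℂ, ℂ) p).right_inv hz₁t
  have hy₁D : y₁ ∈ closedChartDisc p R := by
    refine ⟨(extChartAt 𝓘(ℂ, ℂ) p).map_target hz₁t, ?_⟩
    rw [mem_preimage, hy₁e]; exact sphere_subset_closedBall hz₁
  have hy₁s : extChartAt 𝓘(ℂ, ℂ) p y₁ ∈ sphere c R := by rw [hy₁e]; exact hz₁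
  intro y hy
  refine (hmax hy).trans ?_
  by_cases hb : extChartAt 𝓘(ℂ, ℂ) p y₀ ∈ sphere c R
  · exact hK y₀ hy₀ hb
  · -- interior maximum: `w` is constant on the open disc, hence at the boundary point `y₁`
    have hy₀D : y₀ ∈ chartDisc p R := by
      refine ⟨hy₀.1, mem_ball.2 (lt_of_le_of_ne (mem_closedBall.1 hy₀.2) ?_)⟩
      exact fun h => hb (mem_sphere.2 h)
    have hconst : EqOn w (fun _ => w y₀) (chartDisc p R) :=
      hw.eqOn_of_isMaxOn isOpen_chartDisc (isPreconnected_chartDisc hD) hy₀D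
        (hmax.on_subset chartDisc_subset_closedChartDisc)
    have hcl : y₁ ∈ closure (chartDisc p R) := mem_closure_chartDisc_of_mem_sphere hD hy₁D hy₁s
    have hconst' : EqOn w (fun _ => w y₀) (insert y₁ (chartDisc p R)) :=
      hconst.of_subset_closure (hwc.mono (insert_subset hy₁D chartDisc_subset_closedChartDisc))
        continuousOn_const (subset_insert _ _) (insert_subset hcl subset_closure)
    have : w y₁ = w y₀ := hconst' (mem_insert _ _)
    rw [← this]
    exact hK y₁ hy₁D hy₁s

end IsSubharmonicOn


end RiemannSurface

end Literature.Geometry.Kaehler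

end
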